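import Literature.NumberTheory.EllipticCurves.FineSelmerClassGroupCriterion
import Literature.NumberTheory.NumberFields.ClassGroupNormGalois
import HarnessLib

/-!
# Deo–Ray–Sujatha's hypothesis (c2) `Hom_G(H′_L, E[p]) = 0` from ONE class number:
# `p ∤ #Gal(ℚ(E[p])/ℚ)` and `p ∤ h(ℚ(P))` for a single non-zero `p`-torsion point `P`

Topic `NumberTheory/EllipticCurves`, sub-namespace `DeoRaySujatha2023` (the hypothesis discharged is
(c2) of [DeoRaySujatha2023] Thm. 3.8/3.9 in the VERBATIM form of the tree's named fact
`thm39_fineSelmerDual_moduleFinite_of_homTrivial_divisionField`, file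
`FineSelmerClassGroupCriterion.lean`). THEOREM-ONLY file: no definition, no named fact, no `sorry`;
unconditional except for the two corollaries that take the named fact as a hypothesis `(h : …)`.
Written by the literature seat `bsd-potss-conjA-anchor` g8 (cell `bsd-potss`, rungs K9/KT of
`BirchSwinnertonDyer`) as the kernel discharge the cell planner asked for (plan g24, 2026-08-27:
«Promotion K′ → K for a row needs the kernel discharge “5 ∤ #G ∧ 5 ∤ h(ℚ(P)) ⟹ (c2)”»): the cell's
census of the (t′) rows at `p = 5` certifies `5 ∤ h(ℚ(P))` for the degree-`8`/`24` field of ONE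
`5`-torsion point, never the class number of the degree-`32`/`48`/`96` field `ℚ(E[5])`.

## The statement (folklore; not found in print as a lemma — DRS p. 10: «explicit computation with
## class groups of fields generated by torsion points of elliptic curves is difficult, we do not
## provide an example»; Prasad–Shekhar 2021 bound `Hom_G(Cl/p, E[p])` by a Selmer rank instead)

Let `L/F` be finite Galois inside `F̄` with `G = Gal(L/F)` of order prime to `p`, `V` a `p`-torsion
`Γ_F`-module on which `Γ_L` acts trivially whose only `Γ_F`-stable subgroups are `0` and `V`
(irreducible), `K ⊆ L` a subfield and `P ∈ V ∖ 0` fixed by `Γ_K`, with `p ∤ h_K`.  Then every additive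
`f : Cl(𝓞_L) → V` that is `Γ_F`-equivariant (`f([τI]) = τ f([I])`) is zero.  (Applied with `F = ℚ`.)

Proof (formalised below; Neukirch III (1.6)(iv) + averaging — no Maschke, no Frobenius reciprocity).
Put `H = Gal(L/K)` (`p ∤ #H ∣ #G`) and choose lifts `τ_h ∈ Γ_F`.  The operator `π(v) = Σ_h τ_h v`
satisfies `π(τ_h v) = π(v)` and `π(P) = #H · P ≠ 0`; pick an `𝔽_p`-linear functional `λ` with
`λ(π P) ≠ 0` and set `ε = λ ∘ π`, an `H`-invariant functional with `ε(P) ≠ 0`.  Then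
`μ = ε ∘ f : Cl_L → 𝔽_p` is `H`-invariant, so `#H · μ(c) = μ(∏_h h c) = μ(i_{L/K} N_{L/K} c)` (the
tree's `classGroupExtend_classGroupNorm_eq_prod`, Neukirch III (1.6)(iv) on classes), which is killed by
`h_K` and by `p`, hence vanishes: `μ = 0`.  Finally `U = {v : ε(τ v) = 0 for all τ ∈ Γ_F}` is a
`Γ_F`-stable subgroup containing `f(Cl_L)` (equivariance) and not containing `P`; irreducibility gives
`U = 0`, so `f = 0`.

## Main results

* `equivariantHom_classGroup_eq_zero_of_classNumber_subfield` — the abstract statement above.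
* `homTrivial_divisionField_of_classNumber_subfield` — `L = ℚ(W[p])` (`WeierstrassCurve.divisionField`),
  `V = W[p]`: hypothesis (c2) of `thm39_…_homTrivial_divisionField` VERBATIM, from
  `p ∤ #Gal(ℚ(W[p])/ℚ)`, irreducibility, and a subfield `K ⊆ ℚ(W[p])` with `p ∤ h_K` whose absolute
  Galois group fixes a non-zero `P ∈ W[p]`.
* `thm39_of_homTrivial_of_classNumber_subfield`, `thm39_of_homTrivial_of_classNumber_stabilizerField`
  — Deo–Ray–Sujatha Thm. 3.9 (b) BY NAME (hypothesis `h` = the named fact p499746) with (c2) replaced by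
  that class-number condition; in the second form `K = ℚ(P)` is the fixed field, inside `ℚ(W[p])`, of
  the stabiliser of `P` — the field whose class number the cell's certificates compute.

## References

* S. V. Deo, A. Ray, R. Sujatha, *On the μ equals zero conjecture for fine Selmer groups in Iwasawa
  theory*, Pure Appl. Math. Q. 19 (2023) no. 2, §3 Thm. 3.8 (c2), Thm. 3.9 (b); p. 10 (the remark
  quoted above). [DeoRaySujatha2023]
* J. Neukirch, *Algebraic Number Theory*, Grundlehren 322 (1999), Ch. III §1 Prop. (1.6) (iv)
  (`N_{L|K}(𝔄)𝓞_L = ∏_σ σ𝔄`). [NeukirchANT1999]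
* D. Prasad, S. Shekhar, Pacific J. Math. 312 (2021) 203–218, Thm. 1.1 (another bound for `Hom_G`).
-/

noncomputable section

open scoped Classical

namespace Literature.NumberTheory.EllipticCurves.DeoRaySujatha2023

open WeierstrassCurve IsDedekindDomain NumberField Field
open Literature.NumberTheory.GaloisRepresentations Literature.NumberTheory.NumberFields
open scoped nonZeroDivisors

/-! ### Two elementary helpers -/

/-- An element killed by two coprime natural numbers is zero. [folklore] -/
private theorem eq_zero_of_nsmul_eq_zero_of_coprime {M : Type*} [AddMonoid M] {a b : ℕ}
    (hab : a.Coprime b) {x : M} (ha : a • x = 0) (hb : b • x = 0) : x = 0 := by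
  have hord : addOrderOf x ∣ 1 := by
    rw [← hab]
    exact Nat.dvd_gcd (addOrderOf_dvd_of_nsmul_eq_zero ha) (addOrderOf_dvd_of_nsmul_eq_zero hb)
  exact AddMonoid.addOrderOf_eq_one_iff.mp (Nat.dvd_one.mp hord)

/-- Restriction `Γ_ℚ → Gal(L/ℚ)` to a normal subextension of `ℚ̄/ℚ` is onto (Mathlib
`AlgEquiv.restrictNormalHom_surjective`). [folklore] -/
private theorem absRestrictNormalHom_surjective' {F : Type*} [Field F]
    (E : IntermediateField F (AlgebraicClosure F)) [Normal F E] :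
    Function.Surjective (absRestrictNormalHom E) := fun g => by
  obtain ⟨σ, hσ⟩ := AlgEquiv.restrictNormalHom_surjective (AlgebraicClosure F) g
  exact ⟨(absoluteGaloisGroup.toAlgEquiv F).symm σ, hσ⟩

/-! ### The abstract statement -/

/-- **Equivariant homomorphisms `Cl(𝓞_L) → V` vanish** when `L/F` is finite Galois inside `F̄` with
`p ∤ #Gal(L/F)`, `V` is a `p`-torsion `Γ_F`-module trivialised by `Γ_L` whose only `Γ_F`-stable
subgroups are `⊥` and `⊤`, and some subfield `K ⊆ L` with `p ∤ h_K` has its absolute Galois group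
fixing a non-zero `P ∈ V`.  Equivariance is phrased as in the named fact
`thm39_fineSelmerDual_moduleFinite_of_homTrivial_divisionField` (there with `galRestrict ℤ ℚ`, here with
the equal map `AmbiguousClass.intAut`): `f([J]) = τ • f([I])` whenever `J = τ·I := (τ|_L)(I)`.  Proof in
the module docstring (averaging over lifts of `Gal(L/K)`, a separating `𝔽_p`-functional, Neukirch III
(1.6)(iv) on classes, irreducibility). [folklore] [cite: NeukirchANT1999, Ch. III §1 Prop. (1.6) (iv)] -/
theorem equivariantHom_classGroup_eq_zero_of_classNumber_subfield
    {F : Type} [Field F] (L : IntermediateField F (AlgebraicClosure F)) [FiniteDimensional F L]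
    [IsGalois F L] [NumberField L] (p : ℕ) [Fact p.Prime]
    (hG : ¬ p ∣ Nat.card (L ≃ₐ[F] L))
    {V : Type*} [AddCommGroup V] [DistribMulAction (absoluteGaloisGroup F) V]
    (hV : ∀ τ : absoluteGaloisGroup F, absRestrictNormalHom L τ = 1 → ∀ v : V, τ • v = v)
    (hpV : ∀ v : V, p • v = 0)
    (hirr : ∀ U : AddSubgroup V,
      (∀ τ : absoluteGaloisGroup F, ∀ v ∈ U, τ • v ∈ U) → U = ⊥ ∨ U = ⊤)
    (K : IntermediateField F L) [NumberField K] (hK : ¬ p ∣ NumberField.classNumber K)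
    (P : V) (hP0 : P ≠ 0)
    (hPK : ∀ τ : absoluteGaloisGroup F, (∀ x : K, absRestrictNormalHom L τ (x : L) = x) → τ • P = P)
    (f : Additive (ClassGroup (𝓞 L)) →+ V)
    (hf : ∀ (τ : absoluteGaloisGroup F) (I J : (Ideal (𝓞 L))⁰),
      (J : Ideal (𝓞 L)) =
        (I : Ideal (𝓞 L)).map (AmbiguousClass.intAut (absRestrictNormalHom L τ) : 𝓞 L →+* 𝓞 L) →
      f (Additive.ofMul (ClassGroup.mk0 J)) = τ • f (Additive.ofMul (ClassGroup.mk0 I))) :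
    f = 0 := by
  have hp : p.Prime := Fact.out
  -- (S) elements of `Γ_ℚ` with the same restriction to `L` act identically on `V`
  have hS : ∀ τ τ' : absoluteGaloisGroup F,
      absRestrictNormalHom L τ = absRestrictNormalHom L τ' → ∀ v : V, τ • v = τ' • v := by
    intro τ τ' h v
    have h1 : absRestrictNormalHom L (τ'⁻¹ * τ) = 1 := by
      rw [map_mul, map_inv, h, inv_mul_cancel]
    calc τ • v = (τ' * (τ'⁻¹ * τ)) • v := by rw [mul_inv_cancel_left]
      _ = τ' • v := by rw [mul_smul, hV _ h1 v]
  -- the subgroup `H = Gal(L/K)`, of order prime to `p`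
  have hcardG : Nat.card (L ≃ₐ[F] L) = Module.finrank F L := IsGalois.card_aut_eq_finrank F L
  have hcardH : Fintype.card (L ≃ₐ[K] L) = Module.finrank K L := by
    rw [← Nat.card_eq_fintype_card]; exact IsGalois.card_aut_eq_finrank K L
  have hH : ¬ p ∣ Fintype.card (L ≃ₐ[K] L) := by
    intro hdvd
    apply hG
    rw [hcardG, ← Module.finrank_mul_finrank F K L, ← hcardH]
    exact dvd_mul_of_dvd_right hdvd _
  have hHcop : (Fintype.card (L ≃ₐ[K] L)).Coprime p :=
    Nat.coprime_comm.mp ((Nat.Prime.coprime_iff_not_dvd hp).mpr hH)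
  -- lifts `τ_h ∈ Γ_ℚ` of the elements of `H` (through `Gal(L/ℚ)`)
  choose lift hlift using absRestrictNormalHom_surjective' L
  set tl : (L ≃ₐ[K] L) → absoluteGaloisGroup F := fun h => lift (h.restrictScalars F) with htl
  have htl_res : ∀ h : L ≃ₐ[K] L, absRestrictNormalHom L (tl h) = h.restrictScalars F :=
    fun h => hlift _
  have hres_mul : ∀ h h' : L ≃ₐ[K] L,
      (h * h').restrictScalars F = h.restrictScalars F * h'.restrictScalars F :=
    fun _ _ => AlgEquiv.ext fun _ => rfl
  -- each `τ_h` fixes `K` pointwise, hence fixes `P`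
  have htlP : ∀ h : L ≃ₐ[K] L, tl h • P = P := by
    intro h
    refine hPK _ fun x => ?_
    rw [htl_res]
    exact h.commutes x
  -- the averaging operator `π = Σ_h τ_h`
  set π : V →+ V := ∑ h : L ≃ₐ[K] L, DistribSMul.toAddMonoidHom V (tl h) with hπdef
  have hπ : ∀ v : V, π v = ∑ h : L ≃ₐ[K] L, tl h • v := by
    intro v
    rw [hπdef, AddMonoidHom.finsetSum_apply]
    rfl
  have hπ_smul : ∀ (h₀ : L ≃ₐ[K] L) (v : V), π (tl h₀ • v) = π v := by
    intro h₀ v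
    rw [hπ, hπ]
    have key : ∀ h : L ≃ₐ[K] L, tl h • tl h₀ • v = tl (h * h₀) • v := by
      intro h
      rw [← mul_smul]
      refine hS _ _ ?_ v
      rw [map_mul, htl_res, htl_res, htl_res, hres_mul]
    simp_rw [key]
    exact Fintype.sum_equiv (Equiv.mulRight h₀) _ _ fun h => rfl
  have hπP : π P = Fintype.card (L ≃ₐ[K] L) • P := by
    rw [hπ]
    simp_rw [htlP]
    rw [Finset.sum_const, Finset.card_univ]
  have hπP0 : π P ≠ 0 := by
    intro h0
    rw [hπP] at h0
    exact hP0 (eq_zero_of_nsmul_eq_zero_of_coprime hHcop h0 (hpV P))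
  -- a separating `𝔽_p`-functional and the `H`-invariant functional `ε = λ ∘ π`
  letI instM : Module (ZMod p) V := AddCommGroup.zmodModule hpV
  haveI instF : Module.Free (ZMod p) V := @Module.Free.of_divisionRing (ZMod p) V _ _ instM
  haveI instP : Module.Projective (ZMod p) V :=
    @Module.Projective.of_free (ZMod p) _ V _ instM instF
  obtain ⟨lam, hlam⟩ := @Module.Projective.exists_dual_ne_zero V _ (ZMod p) _ instM instP _ hπP0
  set ε : V →+ ZMod p := lam.toAddMonoidHom.comp π with hεdef
  have hε : ∀ v, ε v = lam.toAddMonoidHom (π v) := fun v => rfl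
  have hε_smul : ∀ (h : L ≃ₐ[K] L) (v : V), ε (tl h • v) = ε v := by
    intro h v; rw [hε, hε, hπ_smul]
  have hεP : ε P ≠ 0 := by rw [hε]; exact hlam
  -- `μ = ε ∘ f` is `H`-invariant on `Cl_L`
  set μ : Additive (ClassGroup (𝓞 L)) →+ ZMod p := ε.comp f with hμdef
  have hμ : ∀ a, μ a = ε (f a) := fun a => rfl
  have hμ_gal : ∀ (h : L ≃ₐ[K] L) (c : ClassGroup (𝓞 L)),
      μ (Additive.ofMul (ClassGroup.mulEquiv (AmbiguousClass.intAut h) c)) = μ (Additive.ofMul c) := by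
    intro h c
    obtain ⟨I, rfl⟩ := ClassGroup.mk0_surjective c
    rw [AmbiguousClass.mulEquiv_mk0]
    have hJ : (((⟨_, AmbiguousClass.map_mem_nonZeroDivisors h I⟩ : (Ideal (𝓞 L))⁰) : (Ideal (𝓞 L))⁰) :
        Ideal (𝓞 L)) =
        (I : Ideal (𝓞 L)).map (AmbiguousClass.intAut (absRestrictNormalHom L (tl h)) : 𝓞 L →+* 𝓞 L) := by
      rw [htl_res]
      rfl
    rw [hμ, hμ, hf (tl h) I _ hJ, hε_smul]
  -- `#H · μ(c) = μ(i(N c))`, killed by `h_K` and `p`: `μ = 0`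
  have hμ_norm : ∀ c : ClassGroup (𝓞 L),
      Fintype.card (L ≃ₐ[K] L) • μ (Additive.ofMul c) =
        μ (Additive.ofMul (classGroupExtend K L (classGroupNorm K L c))) := by
    intro c
    rw [classGroupExtend_classGroupNorm_eq_prod K L c, ofMul_prod, map_sum]
    simp_rw [hμ_gal]
    rw [Finset.sum_const, Finset.card_univ]
  have hμ_ext : ∀ d : ClassGroup (𝓞 K),
      NumberField.classNumber K • μ (Additive.ofMul (classGroupExtend K L d)) = 0 := by
    intro d
    rw [← map_nsmul, ← ofMul_pow, ← map_pow]
    have hd : d ^ NumberField.classNumber K = 1 := pow_card_eq_one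
    rw [hd, map_one, ofMul_one, map_zero]
  have hpZ : ∀ m : ZMod p, p • m = 0 := fun m => by
    rw [nsmul_eq_mul, ZMod.natCast_self, zero_mul]
  have hKcop : (NumberField.classNumber K).Coprime p :=
    Nat.coprime_comm.mp ((Nat.Prime.coprime_iff_not_dvd hp).mpr hK)
  have hμ0 : ∀ a, μ a = 0 := by
    intro a
    have hm : μ (Additive.ofMul (classGroupExtend K L (classGroupNorm K L (Additive.toMul a)))) = 0 :=
      eq_zero_of_nsmul_eq_zero_of_coprime hKcop (hμ_ext _) (hpZ _)
    refine eq_zero_of_nsmul_eq_zero_of_coprime hHcop ?_ (hpZ _)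
    rw [← ofMul_toMul a, hμ_norm, hm]
  -- the `Γ_ℚ`-stable subgroup `U = {v : ε(τ v) = 0 ∀ τ}` contains `f(Cl_L)` but not `P`
  set U : AddSubgroup V :=
    ⨅ τ : absoluteGaloisGroup F, (ε.comp (DistribSMul.toAddMonoidHom V τ)).ker with hUdef
  have hmemU : ∀ v : V, v ∈ U ↔ ∀ τ : absoluteGaloisGroup F, ε (τ • v) = 0 := by
    intro v
    rw [hUdef, AddSubgroup.mem_iInf]
    refine forall_congr' fun τ => ?_
    rw [AddMonoidHom.mem_ker]
    rfl
  have hUstab : ∀ τ : absoluteGaloisGroup F, ∀ v ∈ U, τ • v ∈ U := by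
    intro τ v hv
    rw [hmemU] at hv ⊢
    intro τ'
    rw [← mul_smul]
    exact hv _
  have hUP : P ∉ U := by
    intro hPU
    rw [hmemU] at hPU
    exact hεP (by simpa using hPU 1)
  have hUbot : U = ⊥ := by
    rcases hirr U hUstab with h | h
    · exact h
    · exact absurd (h ▸ AddSubgroup.mem_top P) hUP
  have hfU : ∀ a, f a ∈ U := by
    intro a
    obtain ⟨I, hI⟩ := ClassGroup.mk0_surjective (Additive.toMul a)
    have ha : a = Additive.ofMul (ClassGroup.mk0 I) := by rw [hI, ofMul_toMul]
    rw [hmemU, ha]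
    intro τ
    rw [← hf τ I ⟨_, AmbiguousClass.map_mem_nonZeroDivisors (absRestrictNormalHom L τ) I⟩ rfl, ← hμ]
    exact hμ0 _
  ext a
  have : f a ∈ (⊥ : AddSubgroup V) := hUbot ▸ hfU a
  rwa [AddSubgroup.mem_bot] at this

/-! ### The `p`-division field of an elliptic curve over `ℚ` -/

/-- **Hypothesis (c2) of `thm39_fineSelmerDual_moduleFinite_of_homTrivial_divisionField`, verbatim,
from one class number.**  For `W/ℚ` elliptic, `p` prime, `W[p]` irreducible, `p ∤ #Gal(ℚ(W[p])/ℚ)`, and a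
subfield `K ⊆ ℚ(W[p])` with `p ∤ h_K` whose absolute Galois group fixes a non-zero `P ∈ W[p]`: every
additive `f : Cl(𝓞_{ℚ(W[p])}) → W[p]` that is `Γ_ℚ`-equivariant in the sense of the named fact (and, a
hypothesis not used, kills the classes of the primes above `p` and the bad primes) vanishes.
Specialisation of `equivariantHom_classGroup_eq_zero_of_classNumber_subfield` to `L = ℚ(W[p])`
(`WeierstrassCurve.divisionField`; `Γ_L` acts trivially on `W[p]` by
`absRestrictNormalHom_divisionField_eq_one_iff`), `V = W[p]` (`geomTorsion`). [folklore]
[cite: NeukirchANT1999, Ch. III §1 Prop. (1.6) (iv)] [cite: DeoRaySujatha2023, §3 Thm. 3.8 (c2) (arXiv:2202.09937 p. 9)] -/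
theorem homTrivial_divisionField_of_classNumber_subfield
    (W : WeierstrassCurve ℚ) [W.IsElliptic] (p : ℕ) [Fact p.Prime] [NeZero p]
    [NumberField (W.divisionField p)]
    (hirr : W.HasIrreducibleModPGaloisRep p)
    (hG : ¬ p ∣ Nat.card ((W.divisionField p) ≃ₐ[ℚ] (W.divisionField p)))
    (K : IntermediateField ℚ (W.divisionField p)) [NumberField K]
    (hK : ¬ p ∣ NumberField.classNumber K)
    (P : geomTorsion W (p : ℤ)) (hP0 : P ≠ 0)
    (hPK : ∀ τ : absoluteGaloisGroup ℚ,
      (∀ x : K, absRestrictNormalHom (W.divisionField p) τ (x : W.divisionField p) = x) → τ • P = P)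
    (f : Additive (ClassGroup (𝓞 (W.divisionField p))) →+ geomTorsion W (p : ℤ))
    (hf : ∀ (τ : absoluteGaloisGroup ℚ) (I J : (Ideal (𝓞 (W.divisionField p)))⁰),
      (J : Ideal (𝓞 (W.divisionField p))) =
        (I : Ideal (𝓞 (W.divisionField p))).map
          (galRestrict ℤ ℚ (W.divisionField p) (𝓞 (W.divisionField p))
            (absRestrictNormalHom (W.divisionField p) τ)) →
      f (Additive.ofMul (ClassGroup.mk0 J)) = τ • f (Additive.ofMul (ClassGroup.mk0 I))) :
    f = 0 := by
  refine equivariantHom_classGroup_eq_zero_of_classNumber_subfield (W.divisionField p) p hG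
    (fun τ hτ v => (W.absRestrictNormalHom_divisionField_eq_one_iff p τ).mp hτ v) ?_ hirr K hK P hP0
    hPK f ?_
  · -- `W[p]` is `p`-torsion
    intro v
    apply Subtype.ext
    have hv : ((v : geomTorsion W (p : ℤ)) : geomPoints W) ∈
        AddSubgroup.torsionBy (geomPoints W) (p : ℤ) := v.2
    rw [AddSubgroup.torsionBy, Submodule.mem_toAddSubgroup, Submodule.mem_torsionBy_iff] at hv
    rw [AddSubgroupClass.coe_nsmul, ZeroMemClass.coe_zero, ← natCast_zsmul]
    exact hv
  · -- the fact's `galRestrict ℤ ℚ` phrasing of `τ·I` is the `intAut` phrasing (same underlying map)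
    intro τ I J hJ
    refine hf τ I J ?_
    have key : ∀ x : 𝓞 (W.divisionField p),
        galRestrict ℤ ℚ (W.divisionField p) (𝓞 (W.divisionField p))
            (absRestrictNormalHom (W.divisionField p) τ) x =
          AmbiguousClass.intAut (absRestrictNormalHom (W.divisionField p) τ) x := by
      intro x
      refine RingOfIntegers.ext ?_
      exact algebraMap_galRestrict_apply ℤ _ x
    rw [hJ]
    simp only [Ideal.map]
    congr 1
    ext y
    simp only [Set.mem_image, SetLike.mem_coe, RingHom.coe_coe, key]

/-! ### Deo–Ray–Sujatha Thm. 3.9 (b) BY NAME, with (c2) from one class number -/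

/-- **Deo–Ray–Sujatha 2023 Thm. 3.9 (b) (named fact `thm39_…_homTrivial_divisionField`, hypothesis `h`)
with (c2) discharged by a class number of a SUBFIELD of `ℚ(W[p])`**: for `W/ℚ` elliptic, `p` odd,
`W[p]` irreducible, (c1) `p ∤ #Gal(ℚ(W[p])/ℚ)`, a subfield `K ⊆ ℚ(W[p])` with `p ∤ h_K` whose absolute
Galois group fixes some `P ∈ W[p] ∖ 0`, and (c3) (no `D_v`-fixed `p`-torsion at `v = p` and the bad
places), the dual fine Selmer group of `W` over the cyclotomic `ℤ_p`-extension is finitely generated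
over `ℤ_p` (statement (A) of Coates–Sujatha, `∃ γ D` form).  Conditional only on the named fact `h`.
[cite: DeoRaySujatha2023, §3 Thm. 3.8 (c2), Thm. 3.9 (b) (arXiv:2202.09937 pp. 9–10), §5 Lemma 5.1 (p. 17)]
[cite: NeukirchANT1999, Ch. III §1 Prop. (1.6) (iv)] -/
theorem thm39_of_homTrivial_of_classNumber_subfield
    (h : thm39_fineSelmerDual_moduleFinite_of_homTrivial_divisionField)
    (W : WeierstrassCurve ℚ) [W.IsElliptic] (p : ℕ) [Fact p.Prime] (hp : p ≠ 2)
    (hirr : W.HasIrreducibleModPGaloisRep p)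
    (hG : haveI : NeZero p := ⟨(Fact.out : p.Prime).ne_zero⟩
      ¬ p ∣ Nat.card ((W.divisionField p) ≃ₐ[ℚ] (W.divisionField p)))
    (hKP : haveI : NeZero p := ⟨(Fact.out : p.Prime).ne_zero⟩
      haveI : NumberField (W.divisionField p) := NumberField.mk
      ∃ (K : IntermediateField ℚ (W.divisionField p)) (P : geomTorsion W (p : ℤ)),
        ¬ p ∣ NumberField.classNumber K ∧ P ≠ 0 ∧
          ∀ τ : absoluteGaloisGroup ℚ,
            (∀ x : K, absRestrictNormalHom (W.divisionField p) τ (x : W.divisionField p) = x) →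
              τ • P = P)
    (hloc : ∀ v : HeightOneSpectrum (𝓞 ℚ), (((p : ℕ) : 𝓞 ℚ) ∈ v.asIdeal ∨ ¬ W.HasGoodReductionAt v) →
      ∀ x : W.geomPrimaryTorsion p, p • x = 0 →
        (∀ d ∈ Literature.NumberTheory.EllipticCurves.GreenbergSelmer.decomp v, d • x = x) → x = 0)
    (κ : ZpExtension ℚ p) (hκ : κ.IsCyclotomic) :
    ∃ (γ : absoluteGaloisGroup ℚ) (D : W.FineSelmerDualData κ γ),
      Module.Finite ℤ_[p] (RestrictScalars ℤ_[p] (IwasawaAlgebra p) D.X) := by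
  haveI : NeZero p := ⟨(Fact.out : p.Prime).ne_zero⟩
  haveI : NumberField (W.divisionField p) := NumberField.mk
  obtain ⟨K, P, hK, hP0, hPK⟩ := hKP
  refine h W p hp hirr hG ?_ hloc κ hκ
  intro f hf _
  exact homTrivial_divisionField_of_classNumber_subfield W p hirr hG K hK P hP0 hPK f hf

/-- **Deo–Ray–Sujatha 2023 Thm. 3.9 (b) BY NAME, with (c2) from `p ∤ h(ℚ(P))` for ONE non-zero
`p`-torsion point `P`** — `ℚ(P)` being the fixed field, inside `ℚ(W[p])`, of (the image of) the
stabiliser of `P` in `Γ_ℚ`; this is the class number the cell's per-row certificates compute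
(`[ℚ(P):ℚ] = 8` on the `5Ns` rows, `24` on `5Nn/5S4`).  Hypotheses: the named fact `h`; `p` odd;
`W[p]` irreducible; (c1) `p ∤ #Gal(ℚ(W[p])/ℚ)`; `∃ P ≠ 0` with `p ∤ h(ℚ(P))`; (c3).  Conclusion:
statement (A) for `W` at `p` (`∃ γ D` form).  Conditional only on `h`.
[cite: DeoRaySujatha2023, §3 Thm. 3.8 (c2), Thm. 3.9 (b) (arXiv:2202.09937 pp. 9–10), §5 Lemma 5.1 (p. 17)]
[cite: NeukirchANT1999, Ch. III §1 Prop. (1.6) (iv)] -/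
theorem thm39_of_homTrivial_of_classNumber_stabilizerField
    (h : thm39_fineSelmerDual_moduleFinite_of_homTrivial_divisionField)
    (W : WeierstrassCurve ℚ) [W.IsElliptic] (p : ℕ) [Fact p.Prime] (hp : p ≠ 2)
    (hirr : W.HasIrreducibleModPGaloisRep p)
    (hG : haveI : NeZero p := ⟨(Fact.out : p.Prime).ne_zero⟩
      ¬ p ∣ Nat.card ((W.divisionField p) ≃ₐ[ℚ] (W.divisionField p)))
    (hP : haveI : NeZero p := ⟨(Fact.out : p.Prime).ne_zero⟩
      haveI : NumberField (W.divisionField p) := NumberField.mk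
      ∃ P : geomTorsion W (p : ℤ), P ≠ 0 ∧
        ¬ p ∣ NumberField.classNumber (IntermediateField.fixedField
          ((MulAction.stabilizer (absoluteGaloisGroup ℚ) P).map
            (absRestrictNormalHom (W.divisionField p)))))
    (hloc : ∀ v : HeightOneSpectrum (𝓞 ℚ), (((p : ℕ) : 𝓞 ℚ) ∈ v.asIdeal ∨ ¬ W.HasGoodReductionAt v) →
      ∀ x : W.geomPrimaryTorsion p, p • x = 0 →
        (∀ d ∈ Literature.NumberTheory.EllipticCurves.GreenbergSelmer.decomp v, d • x = x) → x = 0)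
    (κ : ZpExtension ℚ p) (hκ : κ.IsCyclotomic) :
    ∃ (γ : absoluteGaloisGroup ℚ) (D : W.FineSelmerDualData κ γ),
      Module.Finite ℤ_[p] (RestrictScalars ℤ_[p] (IwasawaAlgebra p) D.X) := by
  haveI : NeZero p := ⟨(Fact.out : p.Prime).ne_zero⟩
  haveI : NumberField (W.divisionField p) := NumberField.mk
  obtain ⟨P, hP0, hK⟩ := hP
  refine thm39_of_homTrivial_of_classNumber_subfield h W p hp hirr hG ⟨_, P, hK, hP0, ?_⟩ hloc κ hκ
  intro τ hτ
  -- `τ|_L` fixes the fixed field of `S = Stab(P)|_L`, so `τ|_L ∈ S`: `τ|_L = τ₀|_L` with `τ₀ P = P`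
  have hmem : absRestrictNormalHom (W.divisionField p) τ ∈
      (MulAction.stabilizer (absoluteGaloisGroup ℚ) P).map (absRestrictNormalHom (W.divisionField p)) := by
    rw [← IntermediateField.fixingSubgroup_fixedField
      ((MulAction.stabilizer (absoluteGaloisGroup ℚ) P).map (absRestrictNormalHom (W.divisionField p))),
      IntermediateField.mem_fixingSubgroup_iff]
    intro x hx
    exact hτ ⟨x, hx⟩
  obtain ⟨τ₀, hτ₀, hres⟩ := Subgroup.mem_map.mp hmem
  have h1 : absRestrictNormalHom (W.divisionField p) (τ₀⁻¹ * τ) = 1 := by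
    rw [map_mul, map_inv, hres, inv_mul_cancel]
  have h2 := (W.absRestrictNormalHom_divisionField_eq_one_iff p (τ₀⁻¹ * τ)).mp h1 P
  rw [mul_smul, inv_smul_eq_iff] at h2
  rw [h2]
  exact hτ₀

end Literature.NumberTheory.EllipticCurves.DeoRaySujatha2023

end
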